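import Summits.AtomisticToContinuum.HydrodynamicLimit.Theorems.LambertianContactSwapSwapGapEntropyTransfer
import HarnessLib

/-!
# `SwapGap` (stmt-AtomisticToContinuum-11850): the REVERSED entropy transfer — `RevRelEntSwap → DetFieldConcentration → SwapGap`

Helper file of the line `Sketch` (v12 §12) for the crux
`Summit.AtomisticToContinuum.HydrodynamicLimit.Theses.LambertianContactSwap.SwapGap`: the stub
`stub_swapGap_of_revRelEntSwap_of_detFieldConcentration` (T17, "the reversed transfer"), the mirror
image of the landed composition `swapGap_of_relEntSwap_of_fieldConcentration` with the roles of the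
two gases exchanged.

Yau's relative entropy method with the DETERMINISTIC GAS'S LAW as reference (Kipnis–Landim 1999,
Ch. 6 §1): with `μ_N := (Λ_N,t)_* (P_N ⊗ γ^ℕ)` (law at time `t` of the route's Lambertian flow
started from the local Gibbs law `P_N` and the Gaussian noise) and `ν_N := (Φ_N,t)_* P_N` (law of
the deterministic hard-sphere flow from the same data), if `KL(μ_N ‖ ν_N)/(N+1) → 0` (S1ʳ) and every
bounded `1`-Lipschitz statistic `G = F ∘ fld(·, χ)` of the three `χ`-tested empirical fields of
`Φ_t` concentrates around its mean `m_N = ∫ G(Φ_t z) dP_N` at speed `N + 1` under `P_N` (S2ʳ), then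
the entropy inequality for events (`tendsto_measure_of_klDiv_div_tendsto_zero`) gives
`(P_N ⊗ γ^ℕ){δ < |G(Λ_t p) − m_N|} → 0` for every `δ > 0`, and boundedness
(`tendsto_integral_sub_of_tendsto_measure`) gives `∫ G(Λ_t p) d(P_N ⊗ γ^ℕ) − m_N → 0`, which is
the conclusion of `SwapGap` up to sign (`m_N` is literally its deterministic term; the route's
inline `let` block is the Literature API `lambertFlow (Torus.geometry (Fin 3)) (hsDiameter σ N)` /
`lambertNoise (Fin 3)` definitionally). Thresholds `σ₀ := min (1/2) (min σ₁ σ₂)`.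

prover-line-stmt-AtomisticToContinuum-11850, line Sketch, stub T17.
-/

noncomputable section

open MeasureTheory Filter Set Topology InformationTheory
open scoped ENNReal

namespace Summit.AtomisticToContinuum.HydrodynamicLimit.Theorems

open Literature.Analysis.FluidPDE Literature.MathematicalPhysics.KineticTheory
open Summit.AtomisticToContinuum.HydrodynamicLimit.Theses.LambertianContactSwap

/-- **T17 · THE REVERSED TRANSFER: S1ʳ ∧ S2ʳ ⟹ SwapGap** — the mirror image of
`swapGap_of_relEntSwap_of_fieldConcentration` with the roles of the two gases exchanged: with
`σ₀ := min (1/2) (min σ₁ σ₂)`, for `σ < σ₀`, Euler data, flows, the `t = 0` hypothesis, `t < T`,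
`χ`, `F`: put `G := F ∘ fld(·, χ)` (measurable, `|G| ≤ 1`), `μ_N := (Λ_N,t)_* (P_N ⊗ γ^ℕ)`,
`ν_N := (Φ_N,t)_* P_N`, `m_N := ∫ G dν_N = ∫ G(Φ_t z) dP_N` (the crux's DETERMINISTIC term).
S2ʳ gives `ν_N{δ < |G − m_N|} ≤ C e^{−(N+1)/C}`, S1ʳ gives `KL(μ_N ‖ ν_N)/(N+1) → 0`, so the entropy
inequality for events (`tendsto_measure_of_klDiv_div_tendsto_zero`) gives `μ_N{δ < |G − m_N|} → 0`,
i.e. `(P_N ⊗ γ^ℕ){δ < |G(Λ_t p) − m_N|} → 0` for every `δ > 0`; boundedness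
(`tendsto_integral_sub_of_tendsto_measure`) gives `∫ G(Λ_t p) d(P_N ⊗ γ^ℕ) − m_N → 0`, which is the
crux up to sign (`Tendsto.neg` / `neg_sub`). [cite: KipnisLandim1999, Ch. 6 §1] -/
theorem stub_swapGap_of_revRelEntSwap_of_detFieldConcentration
    (h1 : ∀ (a₀ θ₀ : T3 → ℝ) (u₀ : T3 → V3), Continuous a₀ → Continuous θ₀ → Continuous u₀ →
      (∀ x, 0 < a₀ x) → (∀ x, 0 < θ₀ x) →
      ∃ σ₀ : ℝ, 0 < σ₀ ∧ ∀ σ : ℝ, 0 < σ → σ < σ₀ →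
        ∀ (T : ℝ) (ρ θ : ℝ → T3 → ℝ) (u : ℝ → T3 → V3), IsHardSphereEulerSolution σ T ρ u θ →
          ∀ Φ : (N : ℕ) → HardSphereFlow (Torus.geometry (Fin 3)) (hsDiameter σ N) (N + 1),
            TendstoHydroFieldsAt (fun N => localGibbsLaw σ a₀ u₀ θ₀ N (Φ N)) Φ ρ u θ 0 →
              ∀ t ∈ Set.Ico 0 T,
                Tendsto (fun N : ℕ =>
                  klDiv (((localGibbsLaw σ a₀ u₀ θ₀ N (Φ N)).prod (lambertNoise (Fin 3))).map
                      (fun p => lambertFlow (Torus.geometry (Fin 3)) (hsDiameter σ N) p.2 p.1 t))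
                    ((localGibbsLaw σ a₀ u₀ θ₀ N (Φ N)).map ((Φ N).flow t)) /
                  ((N : ℝ≥0∞) + 1)) atTop (𝓝 0))
    (h2 : ∀ (a₀ θ₀ : T3 → ℝ) (u₀ : T3 → V3), Continuous a₀ → Continuous θ₀ → Continuous u₀ →
      (∀ x, 0 < a₀ x) → (∀ x, 0 < θ₀ x) →
      ∃ σ₀ : ℝ, 0 < σ₀ ∧ ∀ σ : ℝ, 0 < σ → σ < σ₀ →
        ∀ (T : ℝ) (ρ θ : ℝ → T3 → ℝ) (u : ℝ → T3 → V3), IsHardSphereEulerSolution σ T ρ u θ →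
          ∀ Φ : (N : ℕ) → HardSphereFlow (Torus.geometry (Fin 3)) (hsDiameter σ N) (N + 1),
            TendstoHydroFieldsAt (fun N => localGibbsLaw σ a₀ u₀ θ₀ N (Φ N)) Φ ρ u θ 0 →
              ∀ t ∈ Set.Ico 0 T, ∀ χ : T3 → ℝ, Continuous χ →
                ∀ F : ℝ × V3 × ℝ → ℝ, LipschitzWith 1 F → (∀ y, |F y| ≤ 1) → ∀ δ : ℝ, 0 < δ →
                  ∃ C : ℝ, 0 < C ∧ ∀ N : ℕ,
                    (localGibbsLaw σ a₀ u₀ θ₀ N (Φ N))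
                      {z | δ < |F (empiricalDensityField ((Φ N).flow t z) χ,
                            empiricalMomentumField ((Φ N).flow t z) χ,
                            empiricalEnergyField ((Φ N).flow t z) χ) -
                          ∫ w, F (empiricalDensityField ((Φ N).flow t w) χ,
                            empiricalMomentumField ((Φ N).flow t w) χ,
                            empiricalEnergyField ((Φ N).flow t w) χ)
                            ∂(localGibbsLaw σ a₀ u₀ θ₀ N (Φ N))|} ≤
                      ENNReal.ofReal (C * Real.exp (-(C⁻¹ * ((N : ℝ) + 1))))) :
    SwapGap := by
  delta Summit.AtomisticToContinuum.HydrodynamicLimit.Theses.LambertianContactSwap.SwapGap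
  intro Cfg G ε τ S ldir lpair lstep lstate linst lflow noise fld a₀ θ₀ u₀ ha hθ hu ha0 hθ0
  obtain ⟨σ₁, hσ₁, h1'⟩ := h1 a₀ θ₀ u₀ ha hθ hu ha0 hθ0
  obtain ⟨σ₂, hσ₂, h2'⟩ := h2 a₀ θ₀ u₀ ha hθ hu ha0 hθ0
  refine ⟨min 2⁻¹ (min σ₁ σ₂), lt_min (by norm_num) (lt_min hσ₁ hσ₂), ?_⟩
  intro σ hσ hσlt T ρ θ u hE Φ P h0 t ht χ hχ F hF hF1
  have hσhalf : σ < 2⁻¹ := hσlt.trans_le (min_le_left _ _)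
  have hσ₁' : σ < σ₁ := hσlt.trans_le ((min_le_right _ _).trans (min_le_left _ _))
  have hσ₂' : σ < σ₂ := hσlt.trans_le ((min_le_right _ _).trans (min_le_right _ _))
  -- the laws
  have hPN : ∀ N, IsProbabilityMeasure (P N) := fun N =>
    isProbabilityMeasure_localGibbsLaw ha hθ hu ha0 hθ0 (by linarith) N (Φ N)
  have hnoise : IsProbabilityMeasure noise := by
    show IsProbabilityMeasure (lambertNoise (Fin 3))
    infer_instance
  have hPn : ∀ N, IsProbabilityMeasure ((P N).prod noise) := fun N => by
    haveI := hPN N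
    haveI := hnoise
    infer_instance
  -- measurability of the Lambertian flow (the `let` block is the Literature API definitionally)
  have hΛ : ∀ N, Measurable fun p : Cfg N × (ℕ → EuclideanSpace ℝ (Fin 3)) => lflow σ N p.2 p.1 t :=
    fun N => measurable_lambertFlow_hsDiameter hσ.le hσhalf N t
  -- the bounded measurable statistic `G_N = F ∘ fld`
  have hfld : ∀ N, Measurable fun y : Cfg N => fld N y χ := fun N => measurable_fieldTriple hχ
  have hG : ∀ N, Measurable fun y : Cfg N => F (fld N y χ) :=
    fun N => hF.continuous.measurable.comp (hfld N)
  -- the two image laws (roles exchanged: `μ` Lambertian, `ν` deterministic)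
  set μ : (N : ℕ) → Measure (Cfg N) := fun N =>
    ((P N).prod noise).map (fun p => lflow σ N p.2 p.1 t) with hμ
  set ν : (N : ℕ) → Measure (Cfg N) := fun N => (P N).map ((Φ N).flow t) with hν
  haveI hμfin : ∀ N, IsFiniteMeasure (μ N) := fun N => by
    haveI := hPN N
    exact Measure.isFiniteMeasure_map _ _
  haveI hνfin : ∀ N, IsFiniteMeasure (ν N) := fun N => by
    haveI := hPN N
    exact Measure.isFiniteMeasure_map _ _
  -- the deterministic means
  set m : ℕ → ℝ := fun N => ∫ z, F (fld N ((Φ N).flow t z) χ) ∂(P N) with hm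
  have hm1 : ∀ N, |m N| ≤ 1 := fun N => by
    haveI := hPN N
    have h := norm_integral_le_of_norm_le_const (μ := P N)
      (f := fun z : Cfg N => F (fld N ((Φ N).flow t z) χ))
      (C := 1) (ae_of_all _ fun z => by
        rw [Real.norm_eq_abs]
        exact hF1 _)
    simpa [hm, Real.norm_eq_abs] using h
  -- S1ʳ: `KL(μ_N ‖ ν_N)/(N+1) → 0`
  have hkl : Tendsto (fun N : ℕ => klDiv (μ N) (ν N) / ((N : ℝ≥0∞) + 1)) atTop (𝓝 0) :=
    h1' σ hσ hσ₁' T ρ θ u hE Φ h0 t ht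
  -- convergence in `P_N ⊗ γ^ℕ`-probability of `G(Λ_t p)` towards the deterministic mean
  have hprob : ∀ δ : ℝ, 0 < δ →
      Tendsto (fun N => ((P N).prod noise)
        {p | δ < |F (fld N (lflow σ N p.2 p.1 t) χ) - m N|}) atTop (𝓝 0) := by
    intro δ hδ
    obtain ⟨C, hC, hconc⟩ := h2' σ hσ hσ₂' T ρ θ u hE Φ h0 t ht χ hχ F hF hF1 δ hδ
    set A : (N : ℕ) → Set (Cfg N) := fun N => {y | δ < |F (fld N y χ) - m N|} with hA
    have hAm : ∀ N, MeasurableSet (A N) := fun N =>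
      measurableSet_lt measurable_const ((hG N).sub measurable_const).abs
    have hνA : ∀ N, ν N (A N) ≤ ENNReal.ofReal (C * Real.exp (-(C⁻¹ * ((N : ℝ) + 1)))) := by
      intro N
      rw [hν, Measure.map_apply ((Φ N).measurable_flow t) (hAm N)]
      exact hconc N
    have hμA := tendsto_measure_of_klDiv_div_tendsto_zero μ ν A hC hνA hkl
    refine hμA.congr fun N => ?_
    rw [hμ, Measure.map_apply (hΛ N) (hAm N)]
    rfl
  -- merging of the means
  have hmerge := tendsto_integral_sub_of_tendsto_measure
    (Ω := fun N => Cfg N × (ℕ → EuclideanSpace ℝ (Fin 3))) (fun N => (P N).prod noise) hPn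
    (fun N p => F (fld N (lflow σ N p.2 p.1 t) χ)) (fun N => (hG N).comp (hΛ N))
    (fun N p => hF1 _) m hm1 hprob
  -- the crux is the sign-flipped statement
  have hfinal := hmerge.neg
  rw [neg_zero] at hfinal
  refine hfinal.congr fun N => ?_
  exact neg_sub _ _

end Summit.AtomisticToContinuum.HydrodynamicLimit.Theorems

end
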